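import Literature.Topology.FourManifolds.SphereGenusSplitting
import Literature.Topology.FourManifolds.HeightDictionary
import Literature.Topology.FourManifolds.BandSumModel
import Mathlib.Analysis.InnerProductSpace.Calculus
import HarnessLib

/-!
# Height functions on the round sphere are Morse; a surface germ through the equator

Topic `Literature/Topology/FourManifolds`; groundwork for the Euler count of simplified broken
Lefschetz fibrations (Baykur 2012, Lemma 7), whose Morse-theoretic reading composes the
fibration with a height function `⟪a, ·⟫` of the base `S²` after the round image has been
moved to the equator.  Everything here is PROVED; no definitions, no named facts.

* `SphereHeight.isMorse_height` — **every height function `⟪a, ·⟫`, `a ≠ 0`, on the round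
  sphere `𝕊ⁿ ⊆ ℝⁿ⁺¹` is a Morse function** (Milnor 1963, §6: the critical points `± a/‖a‖`
  are nondegenerate; here through the tree's dictionary `HeightDictionary.isMorse_inner_comp_iff`
  with the defining function `‖x‖² - 1`, whose second derivative `2⟪·, ·⟫` is definite).  The
  tree had this only for almost every `a` (`SphereHeight.exists_isMorse_height`).
* `SphereGerm.*` — elementary calculus of a `C²` germ `Γ : ℝ² → ℝ³` at `0` with values in the
  unit sphere, carrying the first axis into the equator `{x₂ = 0}`, with injective
  differential at `0` (this is the germ `Γ = Φ ∘ ψ⁻¹` of the base diffeomorphism read in a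
  fold chart, at a point of the round locus): tangency `⟪Γ 0, DΓ(0) w⟫ = 0`; the axis
  derivatives of the last coordinate vanish to second order; `∂₀Γ₀(0) = 0` iff
  `Γ 0 = (±1, 0, 0)`, and then `∂₀Γ₁(0) ≠ 0`, `∂₀₀Γ₀(0) = -Γ₀(0) ∂₀Γ₁(0)²`, `∂₁Γ₀(0) = 0`,
  `∂₁Γ₂(0) ≠ 0` — the signs that make the two critical points on the round locus of the
  heights `⟪(sin β, 0, cos β), ·⟫` and `⟪(-sin β, 0, cos β), ·⟫` cancel in pairs.

## References

* J. Milnor, *Morse theory*, Ann. of Math. Studies 51 (1963), §6. [Milnor1963]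
* R. İ. Baykur, *Broken Lefschetz fibrations and smooth structures on 4-manifolds*, Geom.
  Topol. Monogr. 18 (2012), Lemma 7. [Baykur2012]
-/

noncomputable section

open scoped Manifold ContDiff Topology RealInnerProductSpace
open Set Function Filter Metric

namespace Literature.Topology.FourManifolds

/-! ### Every height function on the round sphere is Morse -/

namespace SphereHeight

variable {n : ℕ}

/-- **Every height function `⟪a, ·⟫`, `a ≠ 0`, on the round sphere is a Morse function**
(Milnor 1963, §6).  Via the tree's dictionary `HeightDictionary.isMorse_inner_comp_iff` for the
hypersurface `𝕊ⁿ = {‖x‖² - 1 = 0}`: at a horizontal point the second derivative `2⟪·, ·⟫`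
of the defining function is definite on `aᗮ`, hence nondegenerate. [cite: Milnor1963, §6] -/
theorem isMorse_height {a : EuclideanSpace ℝ (Fin (n + 1))} (ha : a ≠ 0) : IsMorse (𝓡 n) (height a) := by
  haveI : IsManifold (𝓡 n) 2 ((Metric.sphere (0 : EuclideanSpace ℝ (Fin (n + 1))) 1)) := IsManifold.of_le (n := ∞) (by norm_cast)
  have hdim : Module.finrank ℝ (EuclideanSpace ℝ (Fin (n + 1))) = n + 1 := finrank_euclideanSpace_fin
  haveI : Fact (Module.finrank ℝ (EuclideanSpace ℝ (Fin (n + 1))) = n + 1) := ⟨hdim⟩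
  set F : EuclideanSpace ℝ (Fin (n + 1)) → ℝ := fun x => ‖x‖ ^ 2 - 1 with hF
  have hFc : ContDiff ℝ 2 F := (contDiff_norm_sq ℝ).sub contDiff_const
  have hDF : ∀ x : EuclideanSpace ℝ (Fin (n + 1)), fderiv ℝ F x = (2 : ℝ) • innerSL ℝ x := fun x => by
    have h : HasFDerivAt F ((2 : ℕ) • innerSL ℝ x - 0) x :=
      (hasStrictFDerivAt_norm_sq x).hasFDerivAt.sub (hasFDerivAt_const (1 : ℝ) x)
    rw [h.fderiv, sub_zero, ← Nat.cast_smul_eq_nsmul ℝ]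
    norm_num
  have hFf : ∀ y : (Metric.sphere (0 : EuclideanSpace ℝ (Fin (n + 1))) 1), F (y : EuclideanSpace ℝ (Fin (n + 1))) = 0 := fun y => by
    simp [hF, norm_eq_of_mem_sphere y]
  have hDF0 : ∀ y : (Metric.sphere (0 : EuclideanSpace ℝ (Fin (n + 1))) 1), fderiv ℝ F (y : EuclideanSpace ℝ (Fin (n + 1))) ≠ 0 := fun y => by
    rw [hDF]
    have hy : (y : EuclideanSpace ℝ (Fin (n + 1))) ≠ 0 := by
      intro h
      have := norm_eq_of_mem_sphere y
      rw [h, norm_zero] at this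
      exact zero_ne_one this
    exact HeightDictionary.smul_innerSL_ne_zero hy two_ne_zero
  have hD2 : ∀ (x w w' : EuclideanSpace ℝ (Fin (n + 1))), fderiv ℝ (fderiv ℝ F) x w w' = 2 * ⟪w, w'⟫ := by
    intro x w w'
    have hfun : fderiv ℝ F = fun x => (2 : ℝ) • innerSL ℝ x := funext hDF
    have hlin : HasFDerivAt (fun x : EuclideanSpace ℝ (Fin (n + 1)) => (2 : ℝ) • innerSL ℝ x)
        ((2 : ℝ) • (innerSL ℝ : EuclideanSpace ℝ (Fin (n + 1)) →L[ℝ] EuclideanSpace ℝ (Fin (n + 1)) →L[ℝ] ℝ)) x :=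
      ((innerSL ℝ : EuclideanSpace ℝ (Fin (n + 1)) →L[ℝ] EuclideanSpace ℝ (Fin (n + 1)) →L[ℝ] ℝ).hasFDerivAt).const_smul (2 : ℝ)
    rw [hfun, hlin.fderiv]
    simp
    rfl
  have key := (HeightDictionary.isMorse_inner_comp_iff (M := (Metric.sphere (0 : EuclideanSpace ℝ (Fin (n + 1))) 1)) (m := n) hdim
    (f := fun y : (Metric.sphere (0 : EuclideanSpace ℝ (Fin (n + 1))) 1) => (y : EuclideanSpace ℝ (Fin (n + 1)))) contMDiff_coe_sphere
    (fun y => mfderiv_coe_sphere_injective y) hFc hFf hDF0 ha).2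
  refine key fun y c _ w _ hw' => ?_
  have h := hw' w (by assumption)
  rw [hD2] at h
  have : ⟪w, w⟫ = 0 := by linarith
  exact inner_self_eq_zero.1 this

/-- The height function `⟪a, ·⟫`, `a ≠ 0`, has exactly the two critical points `± a/‖a‖`, of
Morse index `n` (the maximum) and `0` (the minimum). [cite: Milnor1963, §6] -/
theorem morseIndex_top_eq {a : EuclideanSpace ℝ (Fin (n + 1))} (ha : a ≠ 0) :
    morseIndex (𝓡 n) (height a) (top ha) = n ∧ morseIndex (𝓡 n) (height a) (bot ha) = 0 :=
  ⟨morseIndex_top ha (isMorse_height ha), morseIndex_bot ha (isMorse_height ha)⟩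

end SphereHeight

/-! ### A `C²` germ `ℝ² → 𝕊² ⊆ ℝ³` carrying the first axis into the equator -/

namespace SphereGerm

variable {Γ : EuclideanSpace ℝ (Fin 2) → EuclideanSpace ℝ (Fin 3)}

/-- **Tangency**: if `‖Γ‖ = 1` near `y` and `Γ` is differentiable at `y` then
`⟪Γ y, DΓ(y) w⟫ = 0` (differentiate `‖Γ‖² = 1`). [folklore] -/
theorem inner_fderiv_eq_zero {y : EuclideanSpace ℝ (Fin 2)} (hS : ∀ᶠ z in 𝓝 y, ‖Γ z‖ = 1)
    (hd : DifferentiableAt ℝ Γ y) (w : EuclideanSpace ℝ (Fin 2)) : ⟪Γ y, fderiv ℝ Γ y w⟫ = 0 := by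
  have h1 : HasFDerivAt (fun z => ‖Γ z‖ ^ 2) ((2 : ℕ) • (innerSL ℝ (Γ y)).comp (fderiv ℝ Γ y)) y :=
    hd.hasFDerivAt.norm_sq
  have h2 : HasFDerivAt (fun z => ‖Γ z‖ ^ 2) (0 : EuclideanSpace ℝ (Fin 2) →L[ℝ] ℝ) y := by
    refine (hasFDerivAt_const (1 : ℝ) y).congr_of_eventuallyEq ?_
    filter_upwards [hS] with z hz
    simp [hz]
  have h := h1.unique h2
  have := congrArg (fun L : EuclideanSpace ℝ (Fin 2) →L[ℝ] ℝ => L w) h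
  simp only [smul_apply, ContinuousLinearMap.comp_apply, innerSL_apply_apply,
    zero_apply, nsmul_eq_mul, Nat.cast_ofNat, mul_eq_zero,
    OfNat.ofNat_ne_zero, false_or] at this
  exact this

/-- The derivative of the curve `t ↦ Γ (t • v)`. [folklore] -/
theorem hasDerivAt_comp_smul {t : ℝ} (v : EuclideanSpace ℝ (Fin 2)) (hd : DifferentiableAt ℝ Γ (t • v)) :
    HasDerivAt (fun s : ℝ => Γ (s • v)) (fderiv ℝ Γ (t • v) v) t := by
  have h1 : HasDerivAt (fun s : ℝ => s • v) v t := by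
    simpa using (hasDerivAt_id t).smul_const v
  exact hd.hasFDerivAt.comp_hasDerivAt t h1

/-- `Γ` is differentiable near `0`. [folklore] -/
theorem eventually_differentiableAt (hΓ : ContDiffAt ℝ 2 Γ 0) :
    ∀ᶠ y in 𝓝 (0 : EuclideanSpace ℝ (Fin 2)), DifferentiableAt ℝ Γ y :=
  (hΓ.eventually (by simp)).mono fun _ hy => hy.differentiableAt (by simp)

/-- The derivative of the `CLM`-valued map `t ↦ DΓ(t v)` at `0`, evaluated: the curve
`t ↦ DΓ(t v) v` has derivative `D²Γ(0)(v, v)` at `0`. [folklore] -/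
theorem hasDerivAt_fderiv_comp_smul (hΓ : ContDiffAt ℝ 2 Γ 0) (v : EuclideanSpace ℝ (Fin 2)) :
    HasDerivAt (fun t : ℝ => fderiv ℝ Γ (t • v) v) (fderiv ℝ (fderiv ℝ Γ) 0 v v) 0 := by
  have hD : DifferentiableAt ℝ (fderiv ℝ Γ) ((0 : ℝ) • v) := by
    rw [zero_smul]
    exact (hΓ.fderiv_right (m := 1) (by norm_num)).differentiableAt (by simp)
  have h1 : HasDerivAt (fun s : ℝ => s • v) v 0 := by
    simpa using (hasDerivAt_id (0 : ℝ)).smul_const v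
  have h2 : HasDerivAt (fun t : ℝ => fderiv ℝ Γ (t • v)) (fderiv ℝ (fderiv ℝ Γ) 0 v) 0 := by
    have := hD.hasFDerivAt.comp_hasDerivAt (0 : ℝ) h1
    rw [zero_smul] at this
    exact this
  exact (ContinuousLinearMap.apply ℝ (EuclideanSpace ℝ (Fin 3)) v).hasFDerivAt.comp_hasDerivAt (0 : ℝ) h2

/-- Tangency near `0`: `⟪Γ y, DΓ(y) w⟫ = 0` for all `y` near `0`. [folklore] -/
theorem eventually_inner_fderiv_eq_zero (hΓ : ContDiffAt ℝ 2 Γ 0)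
    (hS : ∀ᶠ y in 𝓝 (0 : EuclideanSpace ℝ (Fin 2)), ‖Γ y‖ = 1) :
    ∀ᶠ y in 𝓝 (0 : EuclideanSpace ℝ (Fin 2)), ∀ w, ⟪Γ y, fderiv ℝ Γ y w⟫ = 0 := by
  have hS' : ∀ᶠ y in 𝓝 (0 : EuclideanSpace ℝ (Fin 2)), ∀ᶠ z in 𝓝 y, ‖Γ z‖ = 1 := eventually_eventually_nhds.2 hS
  filter_upwards [hS', eventually_differentiableAt hΓ] with y hy hd w
  exact inner_fderiv_eq_zero hy hd w

/-- **Second-order tangency along a line**: `⟪Γ 0, D²Γ(0)(v, v)⟫ = -‖DΓ(0) v‖²` (differentiate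
`⟪Γ(t v), DΓ(t v) v⟫ = 0` at `t = 0`). [folklore] -/
theorem inner_fderiv_fderiv_eq (hΓ : ContDiffAt ℝ 2 Γ 0)
    (hS : ∀ᶠ y in 𝓝 (0 : EuclideanSpace ℝ (Fin 2)), ‖Γ y‖ = 1) (v : EuclideanSpace ℝ (Fin 2)) :
    ⟪Γ 0, fderiv ℝ (fderiv ℝ Γ) 0 v v⟫ = -‖fderiv ℝ Γ 0 v‖ ^ 2 := by
  -- the scalar function `t ↦ ⟪Γ (t v), DΓ(t v) v⟫` vanishes near `0`
  have hline : Tendsto (fun t : ℝ => t • v) (𝓝 0) (𝓝 (0 : EuclideanSpace ℝ (Fin 2))) := by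
    have : Continuous fun t : ℝ => t • v := continuous_id.smul continuous_const
    simpa using this.tendsto 0
  have hzero : ∀ᶠ t in 𝓝 (0 : ℝ), ⟪Γ (t • v), fderiv ℝ Γ (t • v) v⟫ = 0 :=
    (hline.eventually (eventually_inner_fderiv_eq_zero hΓ hS)).mono fun t ht => ht v
  have hd0 : DifferentiableAt ℝ Γ ((0 : ℝ) • v) := by
    rw [zero_smul]; exact hΓ.differentiableAt (by simp)
  have h1 : HasDerivAt (fun t : ℝ => Γ (t • v)) (fderiv ℝ Γ 0 v) 0 := by
    simpa using hasDerivAt_comp_smul v hd0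
  have h2 := hasDerivAt_fderiv_comp_smul hΓ v
  have h := h1.inner ℝ h2
  have h' : HasDerivAt (fun t : ℝ => ⟪Γ (t • v), fderiv ℝ Γ (t • v) v⟫) 0 0 :=
    (hasDerivAt_const (0 : ℝ) (0 : ℝ)).congr_of_eventuallyEq hzero
  have heq := h.unique h'
  simp only [zero_smul] at heq
  rw [real_inner_self_eq_norm_sq] at heq
  linarith

/-- `Γ 0` lies on the equator: `Γ₂(0) = 0`. [folklore] -/
theorem apply_zero_two
    (hE : ∀ᶠ t in 𝓝 (0 : ℝ), Γ (t • EuclideanSpace.single (0 : Fin 2) (1 : ℝ)) 2 = 0) :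
    Γ 0 2 = 0 := by
  have := hE.self_of_nhds
  simpa using this

/-- **The axis is carried into the equator to first order**: `∂₀Γ₂(0) = 0`. [folklore] -/
theorem fderiv_single_zero_two (hΓ : ContDiffAt ℝ 2 Γ 0)
    (hE : ∀ᶠ t in 𝓝 (0 : ℝ), Γ (t • EuclideanSpace.single (0 : Fin 2) (1 : ℝ)) 2 = 0) :
    fderiv ℝ Γ 0 (EuclideanSpace.single (0 : Fin 2) (1 : ℝ)) 2 = 0 := by
  set e₀ : EuclideanSpace ℝ (Fin 2) := EuclideanSpace.single (0 : Fin 2) (1 : ℝ)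
  have hd0 : DifferentiableAt ℝ Γ ((0 : ℝ) • e₀) := by
    rw [zero_smul]; exact hΓ.differentiableAt (by simp)
  have h1 : HasDerivAt (fun t : ℝ => Γ (t • e₀) 2) (fderiv ℝ Γ 0 e₀ 2) 0 := by
    have := hasDerivAt_comp_smul e₀ hd0
    rw [zero_smul] at this
    exact (EuclideanSpace.proj (𝕜 := ℝ) (2 : Fin 3)).hasFDerivAt.comp_hasDerivAt (0 : ℝ) this
  have h2 : HasDerivAt (fun t : ℝ => Γ (t • e₀) 2) 0 0 :=
    (hasDerivAt_const (0 : ℝ) (0 : ℝ)).congr_of_eventuallyEq hE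
  exact h1.unique h2

/-- **… and to second order**: `∂₀₀Γ₂(0) = 0`. [folklore] -/
theorem fderiv_fderiv_single_zero_two (hΓ : ContDiffAt ℝ 2 Γ 0)
    (hE : ∀ᶠ t in 𝓝 (0 : ℝ), Γ (t • EuclideanSpace.single (0 : Fin 2) (1 : ℝ)) 2 = 0) :
    fderiv ℝ (fderiv ℝ Γ) 0 (EuclideanSpace.single (0 : Fin 2) (1 : ℝ))
      (EuclideanSpace.single (0 : Fin 2) (1 : ℝ)) 2 = 0 := by
  set e₀ : EuclideanSpace ℝ (Fin 2) := EuclideanSpace.single (0 : Fin 2) (1 : ℝ) with he₀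
  -- near `0`, `t ↦ DΓ(t e₀) e₀` has vanishing last coordinate
  have hline : Tendsto (fun t : ℝ => t • e₀) (𝓝 0) (𝓝 (0 : EuclideanSpace ℝ (Fin 2))) := by
    have : Continuous fun t : ℝ => t • e₀ := continuous_id.smul continuous_const
    simpa using this.tendsto 0
  have hdiff : ∀ᶠ t in 𝓝 (0 : ℝ), DifferentiableAt ℝ Γ (t • e₀) :=
    hline.eventually (eventually_differentiableAt hΓ)
  have hE' : ∀ᶠ t in 𝓝 (0 : ℝ), ∀ᶠ s in 𝓝 t, Γ (s • e₀) 2 = 0 := eventually_eventually_nhds.2 hE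
  have hzero : ∀ᶠ t in 𝓝 (0 : ℝ), fderiv ℝ Γ (t • e₀) e₀ 2 = 0 := by
    filter_upwards [hdiff, hE'] with t ht ht'
    have h1 : HasDerivAt (fun s : ℝ => Γ (s • e₀) 2) (fderiv ℝ Γ (t • e₀) e₀ 2) t :=
      (EuclideanSpace.proj (𝕜 := ℝ) (2 : Fin 3)).hasFDerivAt.comp_hasDerivAt t
        (hasDerivAt_comp_smul e₀ ht)
    have h2 : HasDerivAt (fun s : ℝ => Γ (s • e₀) 2) 0 t :=
      (hasDerivAt_const t (0 : ℝ)).congr_of_eventuallyEq ht'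
    exact h1.unique h2
  have h1 : HasDerivAt (fun t : ℝ => fderiv ℝ Γ (t • e₀) e₀ 2)
      (fderiv ℝ (fderiv ℝ Γ) 0 e₀ e₀ 2) 0 :=
    (EuclideanSpace.proj (𝕜 := ℝ) (2 : Fin 3)).hasFDerivAt.comp_hasDerivAt (0 : ℝ)
      (hasDerivAt_fderiv_comp_smul hΓ e₀)
  have h2 : HasDerivAt (fun t : ℝ => fderiv ℝ Γ (t • e₀) e₀ 2) 0 0 :=
    (hasDerivAt_const (0 : ℝ) (0 : ℝ)).congr_of_eventuallyEq hzero
  exact h1.unique h2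

/-- A vector of `ℝ²` in coordinates. [folklore] -/
theorem eq_smul_add_smul (w : EuclideanSpace ℝ (Fin 2)) :
    w = (w 0) • EuclideanSpace.single (0 : Fin 2) (1 : ℝ) +
      (w 1) • EuclideanSpace.single (1 : Fin 2) (1 : ℝ) := by
  ext i; fin_cases i <;> simp

/-- **The critical points of the height `x₀` along the round image.**  `∂₀Γ₀(0) = 0` iff
`Γ 0 = (±1, 0, 0)`, i.e. iff `Γ₁(0) = 0` (given `Γ₂(0) = 0`): the height `x₀` restricted to
the equator is critical exactly at `(±1, 0, 0)`. [folklore] -/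
theorem fderiv_single_zero_zero_eq_zero_iff (hΓ : ContDiffAt ℝ 2 Γ 0)
    (hS : ∀ᶠ y in 𝓝 (0 : EuclideanSpace ℝ (Fin 2)), ‖Γ y‖ = 1)
    (hE : ∀ᶠ t in 𝓝 (0 : ℝ), Γ (t • EuclideanSpace.single (0 : Fin 2) (1 : ℝ)) 2 = 0)
    (hinj : Injective (fderiv ℝ Γ 0)) :
    fderiv ℝ Γ 0 (EuclideanSpace.single (0 : Fin 2) (1 : ℝ)) 0 = 0 ↔ Γ 0 1 = 0 := by
  set e₀ : EuclideanSpace ℝ (Fin 2) := EuclideanSpace.single (0 : Fin 2) (1 : ℝ) with he₀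
  have htan := inner_fderiv_eq_zero hS (hΓ.differentiableAt (by simp)) e₀
  rw [BandFoliation.inner_eq_three, fderiv_single_zero_two hΓ hE, mul_zero, add_zero] at htan
  have h2 := apply_zero_two hE
  constructor
  · intro h0
    -- `DΓ(0) e₀ = (0, d, 0)` with `d ≠ 0`
    have hd : fderiv ℝ Γ 0 e₀ 1 ≠ 0 := by
      intro h1
      have hz : fderiv ℝ Γ 0 e₀ = 0 := by
        ext i; fin_cases i
        · simpa using h0
        · simpa using h1
        · simpa using fderiv_single_zero_two hΓ hE
      have : e₀ = 0 := hinj (by rw [hz, map_zero])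
      have := congrArg (fun u : EuclideanSpace ℝ (Fin 2) => u 0) this
      simp [he₀] at this
    rw [h0, mul_zero, zero_add] at htan
    exact (mul_eq_zero.1 htan).resolve_right hd
  · intro h1
    have hnorm : ‖Γ 0‖ = 1 := hS.self_of_nhds
    have hsq : Γ 0 0 ^ 2 = 1 := by
      have : ‖Γ 0‖ ^ 2 = 1 := by rw [hnorm, one_pow]
      rw [← real_inner_self_eq_norm_sq, BandFoliation.inner_eq_three, h1, h2] at this
      nlinarith
    have hne : Γ 0 0 ≠ 0 := fun h => by rw [h] at hsq; norm_num at hsq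
    rw [h1, zero_mul, add_zero] at htan
    exact (mul_eq_zero.1 htan).resolve_left hne

/-- **The Morse data at a critical point of the height along the round image.**  If
`∂₀Γ₀(0) = 0` then: `Γ₀(0) = ±1`; `∂₀Γ₁(0) ≠ 0`; `∂₀₀Γ₀(0) = -Γ₀(0) · ∂₀Γ₁(0)²` (so the height
`x₀` along the equator has a nondegenerate maximum at `(1, 0, 0)` and minimum at `(-1, 0, 0)`
in the parameter `t`); `∂₁Γ₀(0) = 0` (tangency); and `∂₁Γ₂(0) ≠ 0` (transversality of the
second chart direction to the equator). [folklore] -/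
theorem morseData_of_fderiv_single_zero_zero_eq_zero (hΓ : ContDiffAt ℝ 2 Γ 0)
    (hS : ∀ᶠ y in 𝓝 (0 : EuclideanSpace ℝ (Fin 2)), ‖Γ y‖ = 1)
    (hE : ∀ᶠ t in 𝓝 (0 : ℝ), Γ (t • EuclideanSpace.single (0 : Fin 2) (1 : ℝ)) 2 = 0)
    (hinj : Injective (fderiv ℝ Γ 0))
    (h0 : fderiv ℝ Γ 0 (EuclideanSpace.single (0 : Fin 2) (1 : ℝ)) 0 = 0) :
    (Γ 0 0 = 1 ∨ Γ 0 0 = -1) ∧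
    fderiv ℝ Γ 0 (EuclideanSpace.single (0 : Fin 2) (1 : ℝ)) 1 ≠ 0 ∧
    fderiv ℝ (fderiv ℝ Γ) 0 (EuclideanSpace.single (0 : Fin 2) (1 : ℝ))
        (EuclideanSpace.single (0 : Fin 2) (1 : ℝ)) 0 =
      -(Γ 0 0) * (fderiv ℝ Γ 0 (EuclideanSpace.single (0 : Fin 2) (1 : ℝ)) 1) ^ 2 ∧
    fderiv ℝ Γ 0 (EuclideanSpace.single (1 : Fin 2) (1 : ℝ)) 0 = 0 ∧
    fderiv ℝ Γ 0 (EuclideanSpace.single (1 : Fin 2) (1 : ℝ)) 2 ≠ 0 := by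
  set e₀ : EuclideanSpace ℝ (Fin 2) := EuclideanSpace.single (0 : Fin 2) (1 : ℝ) with he₀
  set e₁ : EuclideanSpace ℝ (Fin 2) := EuclideanSpace.single (1 : Fin 2) (1 : ℝ) with he₁
  have h1 : Γ 0 1 = 0 := (fderiv_single_zero_zero_eq_zero_iff hΓ hS hE hinj).1 h0
  have h2 := apply_zero_two hE
  have hd2 := fderiv_single_zero_two hΓ hE
  have hnorm : ‖Γ 0‖ = 1 := hS.self_of_nhds
  have hsq : Γ 0 0 ^ 2 = 1 := by
    have : ‖Γ 0‖ ^ 2 = 1 := by rw [hnorm, one_pow]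
    rw [← real_inner_self_eq_norm_sq, BandFoliation.inner_eq_three, h1, h2] at this
    nlinarith
  have hpm : Γ 0 0 = 1 ∨ Γ 0 0 = -1 := by
    have hprod : (Γ 0 0 - 1) * (Γ 0 0 + 1) = 0 := by linear_combination hsq
    rcases mul_eq_zero.1 hprod with h | h
    · exact Or.inl (by linarith)
    · exact Or.inr (by linarith)
  -- `∂₀Γ₁(0) ≠ 0` by injectivity
  have hd : fderiv ℝ Γ 0 e₀ 1 ≠ 0 := by
    intro hz1
    have hz : fderiv ℝ Γ 0 e₀ = 0 := by
      ext i; fin_cases i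
      · simpa using h0
      · simpa using hz1
      · simpa using hd2
    have : e₀ = 0 := hinj (by rw [hz, map_zero])
    have := congrArg (fun u : EuclideanSpace ℝ (Fin 2) => u 0) this
    simp [he₀] at this
  -- second order: `⟪Γ 0, D²Γ e₀ e₀⟫ = -‖DΓ e₀‖²`
  have hsec := inner_fderiv_fderiv_eq hΓ hS e₀
  rw [BandFoliation.inner_eq_three, h1, h2, zero_mul, zero_mul, add_zero, add_zero] at hsec
  have hnsq : ‖fderiv ℝ Γ 0 e₀‖ ^ 2 = (fderiv ℝ Γ 0 e₀ 1) ^ 2 := by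
    rw [← real_inner_self_eq_norm_sq, BandFoliation.inner_eq_three, h0, hd2]; ring
  rw [hnsq] at hsec
  have hsecond : fderiv ℝ (fderiv ℝ Γ) 0 e₀ e₀ 0 = -(Γ 0 0) * (fderiv ℝ Γ 0 e₀ 1) ^ 2 := by
    rcases hpm with h | h
    · rw [h] at hsec ⊢; linarith
    · rw [h] at hsec ⊢; linarith
  -- tangency in the second direction: `Γ₀(0) ∂₁Γ₀(0) = 0`
  have htan1 := inner_fderiv_eq_zero hS (hΓ.differentiableAt (by simp)) e₁
  rw [BandFoliation.inner_eq_three, h1, h2, zero_mul, zero_mul, add_zero, add_zero] at htan1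
  have hne : Γ 0 0 ≠ 0 := fun h => by rw [h] at hsq; norm_num at hsq
  have h10 : fderiv ℝ Γ 0 e₁ 0 = 0 := (mul_eq_zero.1 htan1).resolve_left hne
  -- transversality: `∂₁Γ₂(0) ≠ 0` by injectivity
  have h12 : fderiv ℝ Γ 0 e₁ 2 ≠ 0 := by
    intro hz
    -- `d • DΓ e₁ - (DΓ e₁)₁ • DΓ e₀ = 0`
    set d := fderiv ℝ Γ 0 e₀ 1 with hd'
    set c := fderiv ℝ Γ 0 e₁ 1 with hc'
    have hcomb : fderiv ℝ Γ 0 (d • e₁ - c • e₀) = 0 := by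
      rw [map_sub, map_smul, map_smul]
      ext i; fin_cases i
      · simp [h10, h0]
      · simp [hd', hc']; ring
      · simp [hz]
        exact Or.inr (by simpa using hd2)
    have hzero : d • e₁ - c • e₀ = 0 := hinj (by rw [hcomb, map_zero])
    have := congrArg (fun u : EuclideanSpace ℝ (Fin 2) => u 1) hzero
    simp [he₀, he₁] at this
    exact hd this
  exact ⟨hpm, hd, hsecond, h10, h12⟩

end SphereGerm

end Literature.Topology.FourManifolds
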